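import Summits.AtomisticToContinuum.Crystallization.Theorems.FreeSplittingCertificatesStrictSplittingRuleP1DecisionEven

/-!
# `StrictSplittingRule` (stmt-AtomisticToContinuum-12560): CONFORMITY of the tet–quarter-oct decomposition, ODD cube and assembly — hat functions are the barycentric coordinates (P1 interpolant object, part 4b)

Route `FreeSplittingCertificates`, crux r3 `StrictSplittingRule` (H12⋆ = `stub_coreJointCoercive`), unit b2b-freesplit-B gen 20.
VALUE = fourth brick of item (2) of HOME FAR-LEMMA-SPEC §15 (d) (the P1 INTERPOLANT OBJECT).  NOT a proof of H12⋆, NOT summit progress.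

The two decision lemmas that make the closed-form interpolant `Σ_n p1Hat (q − n) U_n` cellwise affine: on piece `π` of the even/odd
reference cube (`p1RefCell e π`, part 3), the hat function (`p1Hat`, part 2) of each of its four vertices IS that vertex's barycentric
coordinate, and the hat functions of the cube's four other corners VANISH — per piece a linear-arithmetic verification (the ten linear
minorants of the gauge against the four facet inequalities), i.e. the statement that the decomposition is a conforming triangulation whose
vertex stars are the polytopes `{p1Gauge ≤ 1}`.  This file: the ODD cube and assembly.  [folklore: P1 finite elements]
-/

noncomputable section

open Set

namespace Summit.AtomisticToContinuum.Crystallization.Theorems.StrictSplittingRuleBirth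

/-- Vertex identity on piece `0` of the odd cube: the hat function of vertex `m` is the barycentric coordinate `m`. -/
theorem p1Hat_vert_f0 (m : Fin 4) {p : Fin 3 → ℝ} (hp : p ∈ p1RefCell false 0) :
    p1Hat (p1VertPar 0 m) (p - p1Vec (p1VertOff false 0 m)) = p1Bary false 0 m p := by
  have h0 := hp 0; have h1 := hp 1; have h2 := hp 2; have h3 := hp 3
  rw [p1Hat]
  apply le_antisymm
  · refine max_le (hp _) ?_
    refine p1Gauge_oneSub_le_aux ?_
    intro G hk
    obtain ⟨k1, k2, k3, k4, k5, k6, k7, k8, k9, k10⟩ := hk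
    fin_cases m <;>
      simp only [p1Bary, p1BaryCoef, p1VertOff, p1VertPar, p1S, Pi.sub_apply, p1Vec_zero, p1Vec_one, p1Vec_two, Int.cast_zero,
        Int.cast_one, Int.cast_neg, zero_mul, one_mul, neg_mul, zero_add, add_zero, sub_zero]
        at h0 h1 h2 h3 k1 k2 k3 k4 k5 k6 k7 k8 k9 k10 ⊢ <;>
      linarith
  · refine le_max_of_le_right ?_
    rw [le_sub_comm]
    fin_cases m <;>
      simp only [p1Bary, p1BaryCoef, p1VertOff, p1VertPar, Int.cast_zero, Int.cast_one, Int.cast_neg, zero_mul, one_mul,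
        neg_mul, zero_add, add_zero] at h0 h1 h2 h3 ⊢ <;>
      apply p1Gauge_le_of <;>
      simp only [p1S, Pi.sub_apply, p1Vec_zero, p1Vec_one, p1Vec_two, Int.cast_zero, Int.cast_one, one_mul, neg_mul, sub_zero] <;>
      linarith

/-- Vertex identity on piece `1` of the odd cube: the hat function of vertex `m` is the barycentric coordinate `m`. -/
theorem p1Hat_vert_f1 (m : Fin 4) {p : Fin 3 → ℝ} (hp : p ∈ p1RefCell false 1) :
    p1Hat (p1VertPar 1 m) (p - p1Vec (p1VertOff false 1 m)) = p1Bary false 1 m p := by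
  have h0 := hp 0; have h1 := hp 1; have h2 := hp 2; have h3 := hp 3
  rw [p1Hat]
  apply le_antisymm
  · refine max_le (hp _) ?_
    refine p1Gauge_oneSub_le_aux ?_
    intro G hk
    obtain ⟨k1, k2, k3, k4, k5, k6, k7, k8, k9, k10⟩ := hk
    fin_cases m <;>
      simp only [p1Bary, p1BaryCoef, p1VertOff, p1VertPar, p1S, Pi.sub_apply, p1Vec_zero, p1Vec_one, p1Vec_two, Int.cast_zero,
        Int.cast_one, Int.cast_neg, zero_mul, one_mul, neg_mul, zero_add, add_zero, sub_zero]
        at h0 h1 h2 h3 k1 k2 k3 k4 k5 k6 k7 k8 k9 k10 ⊢ <;>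
      linarith
  · refine le_max_of_le_right ?_
    rw [le_sub_comm]
    fin_cases m <;>
      simp only [p1Bary, p1BaryCoef, p1VertOff, p1VertPar, Int.cast_zero, Int.cast_one, Int.cast_neg, zero_mul, one_mul,
        neg_mul, zero_add, add_zero] at h0 h1 h2 h3 ⊢ <;>
      apply p1Gauge_le_of <;>
      simp only [p1S, Pi.sub_apply, p1Vec_zero, p1Vec_one, p1Vec_two, Int.cast_zero, Int.cast_one, one_mul, neg_mul, sub_zero] <;>
      linarith

/-- Vertex identity on piece `2` of the odd cube: the hat function of vertex `m` is the barycentric coordinate `m`. -/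
theorem p1Hat_vert_f2 (m : Fin 4) {p : Fin 3 → ℝ} (hp : p ∈ p1RefCell false 2) :
    p1Hat (p1VertPar 2 m) (p - p1Vec (p1VertOff false 2 m)) = p1Bary false 2 m p := by
  have h0 := hp 0; have h1 := hp 1; have h2 := hp 2; have h3 := hp 3
  rw [p1Hat]
  apply le_antisymm
  · refine max_le (hp _) ?_
    refine p1Gauge_oneSub_le_aux ?_
    intro G hk
    obtain ⟨k1, k2, k3, k4, k5, k6, k7, k8, k9, k10⟩ := hk
    fin_cases m <;>
      simp only [p1Bary, p1BaryCoef, p1VertOff, p1VertPar, p1S, Pi.sub_apply, p1Vec_zero, p1Vec_one, p1Vec_two, Int.cast_zero,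
        Int.cast_one, Int.cast_neg, zero_mul, one_mul, neg_mul, zero_add, add_zero, sub_zero]
        at h0 h1 h2 h3 k1 k2 k3 k4 k5 k6 k7 k8 k9 k10 ⊢ <;>
      linarith
  · refine le_max_of_le_right ?_
    rw [le_sub_comm]
    fin_cases m <;>
      simp only [p1Bary, p1BaryCoef, p1VertOff, p1VertPar, Int.cast_zero, Int.cast_one, Int.cast_neg, zero_mul, one_mul,
        neg_mul, zero_add, add_zero] at h0 h1 h2 h3 ⊢ <;>
      apply p1Gauge_le_of <;>
      simp only [p1S, Pi.sub_apply, p1Vec_zero, p1Vec_one, p1Vec_two, Int.cast_zero, Int.cast_one, one_mul, neg_mul, sub_zero] <;>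
      linarith

/-- Vertex identity on piece `3` of the odd cube: the hat function of vertex `m` is the barycentric coordinate `m`. -/
theorem p1Hat_vert_f3 (m : Fin 4) {p : Fin 3 → ℝ} (hp : p ∈ p1RefCell false 3) :
    p1Hat (p1VertPar 3 m) (p - p1Vec (p1VertOff false 3 m)) = p1Bary false 3 m p := by
  have h0 := hp 0; have h1 := hp 1; have h2 := hp 2; have h3 := hp 3
  rw [p1Hat]
  apply le_antisymm
  · refine max_le (hp _) ?_
    refine p1Gauge_oneSub_le_aux ?_
    intro G hk
    obtain ⟨k1, k2, k3, k4, k5, k6, k7, k8, k9, k10⟩ := hk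
    fin_cases m <;>
      simp only [p1Bary, p1BaryCoef, p1VertOff, p1VertPar, p1S, Pi.sub_apply, p1Vec_zero, p1Vec_one, p1Vec_two, Int.cast_zero,
        Int.cast_one, Int.cast_neg, zero_mul, one_mul, neg_mul, zero_add, add_zero, sub_zero]
        at h0 h1 h2 h3 k1 k2 k3 k4 k5 k6 k7 k8 k9 k10 ⊢ <;>
      linarith
  · refine le_max_of_le_right ?_
    rw [le_sub_comm]
    fin_cases m <;>
      simp only [p1Bary, p1BaryCoef, p1VertOff, p1VertPar, Int.cast_zero, Int.cast_one, Int.cast_neg, zero_mul, one_mul,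
        neg_mul, zero_add, add_zero] at h0 h1 h2 h3 ⊢ <;>
      apply p1Gauge_le_of <;>
      simp only [p1S, Pi.sub_apply, p1Vec_zero, p1Vec_one, p1Vec_two, Int.cast_zero, Int.cast_one, one_mul, neg_mul, sub_zero] <;>
      linarith

/-- Vertex identity on piece `4` of the odd cube: the hat function of vertex `m` is the barycentric coordinate `m`. -/
theorem p1Hat_vert_f4 (m : Fin 4) {p : Fin 3 → ℝ} (hp : p ∈ p1RefCell false 4) :
    p1Hat (p1VertPar 4 m) (p - p1Vec (p1VertOff false 4 m)) = p1Bary false 4 m p := by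
  have h0 := hp 0; have h1 := hp 1; have h2 := hp 2; have h3 := hp 3
  rw [p1Hat]
  apply le_antisymm
  · refine max_le (hp _) ?_
    refine p1Gauge_oneSub_le_aux ?_
    intro G hk
    obtain ⟨k1, k2, k3, k4, k5, k6, k7, k8, k9, k10⟩ := hk
    fin_cases m <;>
      simp only [p1Bary, p1BaryCoef, p1VertOff, p1VertPar, p1S, Pi.sub_apply, p1Vec_zero, p1Vec_one, p1Vec_two, Int.cast_zero,
        Int.cast_one, Int.cast_neg, zero_mul, one_mul, neg_mul, zero_add, add_zero, sub_zero]
        at h0 h1 h2 h3 k1 k2 k3 k4 k5 k6 k7 k8 k9 k10 ⊢ <;>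
      linarith
  · refine le_max_of_le_right ?_
    rw [le_sub_comm]
    fin_cases m <;>
      simp only [p1Bary, p1BaryCoef, p1VertOff, p1VertPar, Int.cast_zero, Int.cast_one, Int.cast_neg, zero_mul, one_mul,
        neg_mul, zero_add, add_zero] at h0 h1 h2 h3 ⊢ <;>
      apply p1Gauge_le_of <;>
      simp only [p1S, Pi.sub_apply, p1Vec_zero, p1Vec_one, p1Vec_two, Int.cast_zero, Int.cast_one, one_mul, neg_mul, sub_zero] <;>
      linarith

/-- Vertex identity on piece `5` of the odd cube: the hat function of vertex `m` is the barycentric coordinate `m`. -/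
theorem p1Hat_vert_f5 (m : Fin 4) {p : Fin 3 → ℝ} (hp : p ∈ p1RefCell false 5) :
    p1Hat (p1VertPar 5 m) (p - p1Vec (p1VertOff false 5 m)) = p1Bary false 5 m p := by
  have h0 := hp 0; have h1 := hp 1; have h2 := hp 2; have h3 := hp 3
  rw [p1Hat]
  apply le_antisymm
  · refine max_le (hp _) ?_
    refine p1Gauge_oneSub_le_aux ?_
    intro G hk
    obtain ⟨k1, k2, k3, k4, k5, k6, k7, k8, k9, k10⟩ := hk
    fin_cases m <;>
      simp only [p1Bary, p1BaryCoef, p1VertOff, p1VertPar, p1S, Pi.sub_apply, p1Vec_zero, p1Vec_one, p1Vec_two, Int.cast_zero,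
        Int.cast_one, Int.cast_neg, zero_mul, one_mul, neg_mul, zero_add, add_zero, sub_zero]
        at h0 h1 h2 h3 k1 k2 k3 k4 k5 k6 k7 k8 k9 k10 ⊢ <;>
      linarith
  · refine le_max_of_le_right ?_
    rw [le_sub_comm]
    fin_cases m <;>
      simp only [p1Bary, p1BaryCoef, p1VertOff, p1VertPar, Int.cast_zero, Int.cast_one, Int.cast_neg, zero_mul, one_mul,
        neg_mul, zero_add, add_zero] at h0 h1 h2 h3 ⊢ <;>
      apply p1Gauge_le_of <;>
      simp only [p1S, Pi.sub_apply, p1Vec_zero, p1Vec_one, p1Vec_two, Int.cast_zero, Int.cast_one, one_mul, neg_mul, sub_zero] <;>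
      linarith

/-- Non-vertex vanishing on piece `0` of the odd cube: the hat functions of the four other cube corners vanish. -/
theorem p1Hat_nonvert_f0 (m : Fin 4) {p : Fin 3 → ℝ} (hp : p ∈ p1RefCell false 0) :
    p1Hat (p1NonVertPar 0 m) (p - p1Vec (p1NonVertOff false 0 m)) = 0 := by
  have h0 := hp 0; have h1 := hp 1; have h2 := hp 2; have h3 := hp 3
  rw [p1Hat]
  apply max_eq_left
  refine p1Gauge_oneSub_le_aux ?_
  intro G hk
  obtain ⟨k1, k2, k3, k4, k5, k6, k7, k8, k9, k10⟩ := hk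
  fin_cases m <;>
    simp only [p1Bary, p1BaryCoef, p1NonVertOff, p1NonVertPar, p1S, Pi.sub_apply, p1Vec_zero, p1Vec_one, p1Vec_two,
      Int.cast_zero, Int.cast_one, Int.cast_neg, zero_mul, one_mul, neg_mul, zero_add, add_zero, sub_zero]
      at h0 h1 h2 h3 k1 k2 k3 k4 k5 k6 k7 k8 k9 k10 ⊢ <;>
    linarith

/-- Non-vertex vanishing on piece `1` of the odd cube: the hat functions of the four other cube corners vanish. -/
theorem p1Hat_nonvert_f1 (m : Fin 4) {p : Fin 3 → ℝ} (hp : p ∈ p1RefCell false 1) :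
    p1Hat (p1NonVertPar 1 m) (p - p1Vec (p1NonVertOff false 1 m)) = 0 := by
  have h0 := hp 0; have h1 := hp 1; have h2 := hp 2; have h3 := hp 3
  rw [p1Hat]
  apply max_eq_left
  refine p1Gauge_oneSub_le_aux ?_
  intro G hk
  obtain ⟨k1, k2, k3, k4, k5, k6, k7, k8, k9, k10⟩ := hk
  fin_cases m <;>
    simp only [p1Bary, p1BaryCoef, p1NonVertOff, p1NonVertPar, p1S, Pi.sub_apply, p1Vec_zero, p1Vec_one, p1Vec_two,
      Int.cast_zero, Int.cast_one, Int.cast_neg, zero_mul, one_mul, neg_mul, zero_add, add_zero, sub_zero]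
      at h0 h1 h2 h3 k1 k2 k3 k4 k5 k6 k7 k8 k9 k10 ⊢ <;>
    linarith

/-- Non-vertex vanishing on piece `2` of the odd cube: the hat functions of the four other cube corners vanish. -/
theorem p1Hat_nonvert_f2 (m : Fin 4) {p : Fin 3 → ℝ} (hp : p ∈ p1RefCell false 2) :
    p1Hat (p1NonVertPar 2 m) (p - p1Vec (p1NonVertOff false 2 m)) = 0 := by
  have h0 := hp 0; have h1 := hp 1; have h2 := hp 2; have h3 := hp 3
  rw [p1Hat]
  apply max_eq_left
  refine p1Gauge_oneSub_le_aux ?_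
  intro G hk
  obtain ⟨k1, k2, k3, k4, k5, k6, k7, k8, k9, k10⟩ := hk
  fin_cases m <;>
    simp only [p1Bary, p1BaryCoef, p1NonVertOff, p1NonVertPar, p1S, Pi.sub_apply, p1Vec_zero, p1Vec_one, p1Vec_two,
      Int.cast_zero, Int.cast_one, Int.cast_neg, zero_mul, one_mul, neg_mul, zero_add, add_zero, sub_zero]
      at h0 h1 h2 h3 k1 k2 k3 k4 k5 k6 k7 k8 k9 k10 ⊢ <;>
    linarith

/-- Non-vertex vanishing on piece `3` of the odd cube: the hat functions of the four other cube corners vanish. -/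
theorem p1Hat_nonvert_f3 (m : Fin 4) {p : Fin 3 → ℝ} (hp : p ∈ p1RefCell false 3) :
    p1Hat (p1NonVertPar 3 m) (p - p1Vec (p1NonVertOff false 3 m)) = 0 := by
  have h0 := hp 0; have h1 := hp 1; have h2 := hp 2; have h3 := hp 3
  rw [p1Hat]
  apply max_eq_left
  refine p1Gauge_oneSub_le_aux ?_
  intro G hk
  obtain ⟨k1, k2, k3, k4, k5, k6, k7, k8, k9, k10⟩ := hk
  fin_cases m <;>
    simp only [p1Bary, p1BaryCoef, p1NonVertOff, p1NonVertPar, p1S, Pi.sub_apply, p1Vec_zero, p1Vec_one, p1Vec_two,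
      Int.cast_zero, Int.cast_one, Int.cast_neg, zero_mul, one_mul, neg_mul, zero_add, add_zero, sub_zero]
      at h0 h1 h2 h3 k1 k2 k3 k4 k5 k6 k7 k8 k9 k10 ⊢ <;>
    linarith

/-- Non-vertex vanishing on piece `4` of the odd cube: the hat functions of the four other cube corners vanish. -/
theorem p1Hat_nonvert_f4 (m : Fin 4) {p : Fin 3 → ℝ} (hp : p ∈ p1RefCell false 4) :
    p1Hat (p1NonVertPar 4 m) (p - p1Vec (p1NonVertOff false 4 m)) = 0 := by
  have h0 := hp 0; have h1 := hp 1; have h2 := hp 2; have h3 := hp 3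
  rw [p1Hat]
  apply max_eq_left
  refine p1Gauge_oneSub_le_aux ?_
  intro G hk
  obtain ⟨k1, k2, k3, k4, k5, k6, k7, k8, k9, k10⟩ := hk
  fin_cases m <;>
    simp only [p1Bary, p1BaryCoef, p1NonVertOff, p1NonVertPar, p1S, Pi.sub_apply, p1Vec_zero, p1Vec_one, p1Vec_two,
      Int.cast_zero, Int.cast_one, Int.cast_neg, zero_mul, one_mul, neg_mul, zero_add, add_zero, sub_zero]
      at h0 h1 h2 h3 k1 k2 k3 k4 k5 k6 k7 k8 k9 k10 ⊢ <;>
    linarith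

/-- Non-vertex vanishing on piece `5` of the odd cube: the hat functions of the four other cube corners vanish. -/
theorem p1Hat_nonvert_f5 (m : Fin 4) {p : Fin 3 → ℝ} (hp : p ∈ p1RefCell false 5) :
    p1Hat (p1NonVertPar 5 m) (p - p1Vec (p1NonVertOff false 5 m)) = 0 := by
  have h0 := hp 0; have h1 := hp 1; have h2 := hp 2; have h3 := hp 3
  rw [p1Hat]
  apply max_eq_left
  refine p1Gauge_oneSub_le_aux ?_
  intro G hk
  obtain ⟨k1, k2, k3, k4, k5, k6, k7, k8, k9, k10⟩ := hk
  fin_cases m <;>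
    simp only [p1Bary, p1BaryCoef, p1NonVertOff, p1NonVertPar, p1S, Pi.sub_apply, p1Vec_zero, p1Vec_one, p1Vec_two,
      Int.cast_zero, Int.cast_one, Int.cast_neg, zero_mul, one_mul, neg_mul, zero_add, add_zero, sub_zero]
      at h0 h1 h2 h3 k1 k2 k3 k4 k5 k6 k7 k8 k9 k10 ⊢ <;>
    linarith

/-- **Vertices**: on piece `π`, the hat function of its vertex `m` (with that site's layer parity) IS the barycentric coordinate of `m`. -/
theorem p1Hat_vert : ∀ (e : Bool) (π : Fin 6) (m : Fin 4) {p : Fin 3 → ℝ}, p ∈ p1RefCell e π →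
    p1Hat (p1VertPar π m) (p - p1Vec (p1VertOff e π m)) = p1Bary e π m p
  | true, 0, m, _, hp => p1Hat_vert_t0 m hp
  | true, 1, m, _, hp => p1Hat_vert_t1 m hp
  | true, 2, m, _, hp => p1Hat_vert_t2 m hp
  | true, 3, m, _, hp => p1Hat_vert_t3 m hp
  | true, 4, m, _, hp => p1Hat_vert_t4 m hp
  | true, 5, m, _, hp => p1Hat_vert_t5 m hp
  | false, 0, m, _, hp => p1Hat_vert_f0 m hp
  | false, 1, m, _, hp => p1Hat_vert_f1 m hp
  | false, 2, m, _, hp => p1Hat_vert_f2 m hp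
  | false, 3, m, _, hp => p1Hat_vert_f3 m hp
  | false, 4, m, _, hp => p1Hat_vert_f4 m hp
  | false, 5, m, _, hp => p1Hat_vert_f5 m hp

/-- **Non-vertices**: on piece `π`, the hat functions of the four cube corners that are not its vertices vanish. -/
theorem p1Hat_nonvert : ∀ (e : Bool) (π : Fin 6) (m : Fin 4) {p : Fin 3 → ℝ}, p ∈ p1RefCell e π →
    p1Hat (p1NonVertPar π m) (p - p1Vec (p1NonVertOff e π m)) = 0
  | true, 0, m, _, hp => p1Hat_nonvert_t0 m hp
  | true, 1, m, _, hp => p1Hat_nonvert_t1 m hp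
  | true, 2, m, _, hp => p1Hat_nonvert_t2 m hp
  | true, 3, m, _, hp => p1Hat_nonvert_t3 m hp
  | true, 4, m, _, hp => p1Hat_nonvert_t4 m hp
  | true, 5, m, _, hp => p1Hat_nonvert_t5 m hp
  | false, 0, m, _, hp => p1Hat_nonvert_f0 m hp
  | false, 1, m, _, hp => p1Hat_nonvert_f1 m hp
  | false, 2, m, _, hp => p1Hat_nonvert_f2 m hp
  | false, 3, m, _, hp => p1Hat_nonvert_f3 m hp
  | false, 4, m, _, hp => p1Hat_nonvert_f4 m hp
  | false, 5, m, _, hp => p1Hat_nonvert_f5 m hp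

end Summit.AtomisticToContinuum.Crystallization.Theorems.StrictSplittingRuleBirth
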